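import Summits.CriticalPhenomena.PercolationContinuityZ3.Theorems.SahiMasterFamilyUCMonotone
import Summits.CriticalPhenomena.PercolationContinuityZ3.Theorems.SahiMasterFamilyUCCertSix

/-!
# `F^{UC}(k)` is MONOTONE in `k`

Unit `prim-masterthm-p4` (gen 16; crux anchor stmt-CriticalPhenomena-4575, helper work; memo
`run/shared/lean/prim/prim-masterthm/prim-masterthm-p4/P4-GEN16-REPORT.md` §6).  Companion of `…UCMonotone` (`pb`, `fixEmpty`, `phiSet_fixEmpty`;
`(UC-hull)_k` monotone) and `…UCCert` (`PhiCert.FUCNonneg`).  The pull-back `(fixEmpty β) ∘ pb` of a point of the linear union-closed relaxation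
`F^{UC}(k+1)` is a point of `F^{UC}(k+2)`: setting `β ∅ := 1` keeps every pairwise-covering inequality (`fixEmpty_cover`: a covering list
containing `∅` is `∅` once and `B` otherwise), and covering lists pull back to covering lists (`pb_union`).  With `phiSet_pullback`:
* **`fucNonneg_anti : FUCNonneg (k+2) → FUCNonneg (k+1)`**, `fucNonneg_of_le : 1 ≤ k → k ≤ k' → FUCNonneg k' → FUCNonneg k`;
* consolidation with `…UCCertSix`: **`fucNonneg_of_le_six : k ≤ 6 → FUCNonneg k`**, **`ucHullNonneg_of_le_six : k ≤ 6 → UCHullNonneg k`**.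
HONEST FRAMING: monotonicity only; `F^{UC}(k)` OPEN for `k ≥ 7` (true k ≤ 6, `…UCCertSix`).  Axioms standard. [this work]
-/

noncomputable section

open scoped Classical

namespace Summit.CriticalPhenomena.PercolationContinuityZ3.Theorems

namespace PhiCert

open Finset
open Literature.Combinatorics.Sahi2008
open PrincipalCapBeta (phiSet)

variable {k : ℕ}

/-- **Setting `β ∅ := 1` keeps the covering inequalities** (given `β ≤ 1`). [this work] -/
theorem fixEmpty_cover (β : Finset (Fin (k + 1)) → ℝ) (h1 : ∀ B, β B ≤ 1)
    (hcov : ∀ (B : Finset (Fin (k + 1))) (L : List (Finset (Fin (k + 1)))), L.Pairwise (fun A A' => A ∪ A' = B) →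
      (L.map β).sum ≤ 1 + ((L.length : ℝ) - 1) * β B)
    (B : Finset (Fin (k + 1))) (L : List (Finset (Fin (k + 1)))) (hL : L.Pairwise (fun A A' => A ∪ A' = B)) :
    (L.map (fixEmpty β)).sum ≤ 1 + ((L.length : ℝ) - 1) * fixEmpty β B := by
  have hf1 : ∀ A, fixEmpty β A ≤ 1 := fun A => by
    unfold fixEmpty; split_ifs
    · exact le_rfl
    · exact h1 A
  by_cases hB : B = ∅
  · -- every value is at most one and the value at `B = ∅` is one
    have hB1 : fixEmpty β B = 1 := by rw [fixEmpty, if_pos hB]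
    rw [hB1, mul_one]
    have : (L.map (fixEmpty β)).sum ≤ (L.map fun _ => (1 : ℝ)).sum := List.sum_le_sum fun A _ => hf1 A
    rw [List.map_const', List.sum_replicate, nsmul_eq_mul, mul_one] at this
    linarith
  · have hBv : fixEmpty β B = β B := by rw [fixEmpty, if_neg hB]
    rw [hBv]
    by_cases hmem : (∅ : Finset (Fin (k + 1))) ∈ L
    · -- `L = L₁ ++ ∅ :: L₂` with all other members equal to `B`
      obtain ⟨L₁, L₂, rfl⟩ := List.append_of_mem hmem
      rw [List.pairwise_append, List.pairwise_cons] at hL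
      obtain ⟨_, ⟨h2, _⟩, h12⟩ := hL
      have hA1 : ∀ A ∈ L₁, A = B := fun A hA => by
        have := h12 A hA ∅ List.mem_cons_self
        rwa [union_empty] at this
      have hA2 : ∀ A ∈ L₂, A = B := fun A hA => by
        have := h2 A hA
        rwa [empty_union] at this
      have e1 : L₁.map (fixEmpty β) = L₁.map fun _ => β B :=
        List.map_congr_left fun A hA => by rw [hA1 A hA, fixEmpty, if_neg hB]
      have e2 : L₂.map (fixEmpty β) = L₂.map fun _ => β B :=
        List.map_congr_left fun A hA => by rw [hA2 A hA, fixEmpty, if_neg hB]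
      have e0 : fixEmpty β ∅ = 1 := by rw [fixEmpty, if_pos rfl]
      rw [List.map_append, List.map_cons, List.sum_append, List.sum_cons, e1, e2, e0, List.map_const', List.map_const',
        List.sum_replicate, List.sum_replicate, nsmul_eq_mul, nsmul_eq_mul, List.length_append, List.length_cons]
      push_cast
      ring_nf
      rfl
    · -- no `∅`: the modified values are the original ones
      have e : L.map (fixEmpty β) = L.map β :=
        List.map_congr_left fun A hA => by rw [fixEmpty, if_neg (fun h => hmem (by rw [← h]; exact hA))]
      rw [e]
      exact hcov B L hL

/-- **Downward step**: `F^{UC}(k+2) ⇒ F^{UC}(k+1)`. [this work] -/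
theorem fucNonneg_anti (h : FUCNonneg (k + 2)) : FUCNonneg (k + 1) := by
  rcases Nat.eq_zero_or_pos k with hk | hk
  · subst hk
    intro β _ _ huniv _
    rw [PrincipalCapBeta.phiSet_one, huniv]; exact zero_le_one
  intro β h0 h1 huniv hcov
  have h0' : ∀ B, 0 ≤ fixEmpty β B := fun B => by
    unfold fixEmpty; split_ifs
    · exact zero_le_one
    · exact h0 B
  have h1' : ∀ B, fixEmpty β B ≤ 1 := fun B => by
    unfold fixEmpty; split_ifs
    · exact le_rfl
    · exact h1 B
  -- the pull-back is a point of `F^{UC}(k+2)`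
  have key := h (fun T => fixEmpty β (pb T)) (fun T => h0' _) (fun T => h1' _)
    (by show fixEmpty β (pb univ) = 1; rw [pb_univ, fixEmpty, if_neg univ_nonempty.ne_empty, huniv])
    (by
      intro B L hL
      have hL' : (L.map pb).Pairwise (fun A A' => A ∪ A' = pb B) := by
        rw [List.pairwise_map]
        exact hL.imp fun {A A'} hAA' => by rw [← pb_union, hAA']
      have := fixEmpty_cover β h1 hcov (pb B) (L.map pb) hL'
      rwa [List.map_map, List.length_map] at this)
  have hfe : fixEmpty β ∅ = 1 := by rw [fixEmpty, if_pos rfl]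
  have epb : (fun T : Finset (Fin (k + 2)) => fixEmpty β (pb T)) =
      fun T => fixEmpty β (univ.filter fun i : Fin (k + 1) => Fin.castSucc i ∈ T) := rfl
  rw [epb, PhiSymmetricLift.phiSet_pullback (fixEmpty β) hfe, phiSet_fixEmpty] at key
  have hk' : (0 : ℝ) < (k : ℝ) := by exact_mod_cast hk
  exact (mul_nonneg_iff_of_pos_left hk').1 key

/-- **`F^{UC}(k)` is monotone**: `F^{UC}(k') ⇒ F^{UC}(k)` for `1 ≤ k ≤ k'`. [this work] -/
theorem fucNonneg_of_le {k k' : ℕ} (hk : 1 ≤ k) (hkk' : k ≤ k') (h : FUCNonneg k') : FUCNonneg k := by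
  induction k' with
  | zero => omega
  | succ m ih =>
    rcases Nat.eq_or_lt_of_le hkk' with heq | hlt
    · rw [heq]; exact h
    · obtain ⟨m', rfl⟩ : ∃ m', m = m' + 1 := ⟨m - 1, by omega⟩
      exact ih (by omega) (fucNonneg_anti h)

/-- **`F^{UC}(k)` for every `k ≤ 6`** (orders `≤ 2`: the box suffices, `GHSmall.phiSet_nonneg_of_box`; `3 ≤ k ≤ 6`: from `fucNonneg_six` by monotonicity). [this work] -/
theorem fucNonneg_of_le_six {k : ℕ} (hk : k ≤ 6) : FUCNonneg k := by
  by_cases h2 : k ≤ 2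
  · intro β h0 h1 huniv _
    exact GHSmall.phiSet_nonneg_of_box h2 β h0 h1 huniv
  · exact fucNonneg_of_le (by omega) hk fucNonneg_six

/-- **`(UC-hull)_k` for every `k ≤ 6`.** [this work] -/
theorem ucHullNonneg_of_le_six {k : ℕ} (hk : k ≤ 6) : GHConjecture.UCHullNonneg k :=
  ucHullNonneg_of_fucNonneg (fucNonneg_of_le_six hk)

end PhiCert

end Summit.CriticalPhenomena.PercolationContinuityZ3.Theorems
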